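import Literature.Analysis.ValidatedNumerics.TaylorModelIntegralCertStrip
import HarnessLib

/-!
# Bivariate Taylor-model box rule for the eight axis-regular Mercier kernels of the Lee–Cerfon / PCF Solov'ev family,
# in the surface label `s` and the Weierstrass half-angle variable `v = tan(t/2)` (shared registers, one pass per box), with its soundness

Venture LADDER-GRIDFUSION, rung F1.MERCIER-profile («F1.MERCIER-WHOLE-PROFILE»; cell `gridfusion`, seat gridfusion-sos-6 (g6),
2026-08-27).  MACHINE PART of the whole-profile Mercier certificates `Bench/SolovevPCF{Iter,Nstx}MercierProfileP*.lean`.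

Context.  gridfusion-model-7's axis-regular form (`Models/SolovevMercierAxisRegular*.lean`) writes Jardin's flux-surface Mercier
criterion (8.134) on the surface `r` of `Ψ = psiLC κ F_B R₀ q₀ a` as `N₀(r) < g²·N₂(r)` with `N₂, N₀` polynomials in eight loop
integrals `I_B, I₆, I₇, I₈, I_X, I_Y, D₃` (over `t ∈ [0, 2π]`) and `D₅` (over `[0, π]`) of kernels that are BOUNDED and smooth down to
the axis `r = 0`.  After the evenness fold `[0, 2π] → 2×[0, π]` and the WEIERSTRASS substitution `t = 2·arctan v` on `[0, π/2]`,
`cos t = (1 − v²)/(1 + v²)`, `sin²t = 4v²/(1 + v²)²`, `dt = 2 dv/(1 + v²)`, plus the reflected branch `t = π − 2·arctan v`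
(`cos ↦ −cos`), every integral is `Σ_{σ = ±1} ∫₀¹ K_i(σ; s, v) dv` with `K_i` ALGEBRAIC in `(s, v)` — RATIONAL but for `√u` —
(`s = r/a` the surface fraction, `rR₀ = s·ε`, `u = R₀² + 2εs·cos t`); the substitution is rational, so the only complex
singularities in `v` are `±i` (distance `≥ 1` from `[0, 1]`: two or three `v`-boxes suffice).  This file supplies, for the tree's
bivariate Taylor-model arithmetic
(`Literature/Analysis/ValidatedNumerics/TaylorModelBivariate{,Elem}.lean`: `tmul2`, `tinv2TM`, `tsqrt2TM`, candidates in-kernel):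

* §1 `KInst` (rational instance data `R₀², ε, 1/κ²`; the two PCF instances of record `KInst.pcfIter`, `KInst.pcfNstx`) and the
  sixteen REAL kernels `ker I σ i s v` (`i = 0…7` ↔ `I_B, I₆, I₇, I₈`,
  `I_X·R₀/2`, `I_Y/4`, `D₃/(−3R₀)`, `D₅/(−5R₀)` — the last two in INTEGRATION-BY-PARTS form `∫sin²t·u^{−5/2}`, `∫₀^π sin²t·u^{−7/2}`
  of model-7's regularised `(1/r)∫cos t·u^{−3/2}`, `(1/r)∫₀^π cos t·u^{−5/2}`; written with `Real.sqrt` / `⁻¹` exactly as the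
  box rule computes them);
* §2 the box REGISTERS `mIP, mC, mS2, mJ, mU, mSU, mISU, mIU, mA, mQ, mIQ, …` (named, so that the kernel shares them) and the VECTOR
  BOX RULE `kerBox S P h cx I σ k cy : List IPoly2 × Bool` — ONE pass per box computing `1/(1+v²), cos t, sin²t, dt/dv, u, √u,
  1/√u, 1/u, Q, 1/Q` once and the eight kernels as products of them (four intrinsic nodes, one of them univariate in `v`);
* §3 **soundness** `kerBox_sound`: `StripSoundV S h 8 (fun i u y => ker I σ i (cx + u) y) (kerBox S P h cx I σ)` — the hypothesis
  of `tmem_stripTMs` (`TaylorModelIntegralCertStrip.lean`), so that `stripTMs` turns every box column over `v ∈ [0, 1]` into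
  eight univariate Taylor models in `s` on the panel `|s − cx| ≤ h`, uniformly and to the order of the box models.
The IDENTIFICATION of `2·Σ_σ ∫₀¹ ker … i s v dv` with model-7's `lcRegIB … lcRegD5` at `r = s·a` (evenness, Weierstrass substitution,
integration by parts for `D₃`, `D₅`, pointwise algebra on `v ∈ [0,1]`, `u > 0`) is instance-level (`Bench/…MercierProfileIdent.lean`);
nothing here depends on it.
HONEST FRAMING: kernel-arithmetic plumbing about MODEL objects (analytic Solov'ev surfaces); no enclosure is claimed in this file,
no statement about any equilibrium or device.  No `decide` here.
-/

open Literature.Analysis.ValidatedNumerics Literature.Analysis.ValidatedNumerics.PolyMP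
open Literature.Analysis.ValidatedNumerics.NumericsMP

namespace Summit.Ventures.FusionMHD.Models.LcMercierProfile

/-! ## §1 Instance data and the real kernels -/

/-- Rational data of a Lee–Cerfon / PCF instance for the box rule: `u0 = R₀²` (axis radius squared), `eps = a·R₀` (so that
`2rR₀ = 2εs` on the surface of fraction `s = r/a`) and `invKsq = 1/κ²` (the in general irrational `R₀`, `κ` themselves never enter
the kernels). [cite: LeeCerfon2015, §4.1 (boundary parametrisation)] -/
structure KInst where
  /-- `R₀²` -/
  u0 : ℚ
  /-- `ε = a·R₀` -/
  eps : ℚ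
  /-- `1/κ²` -/
  invKsq : ℚ

/-- The ITER-like PCF Solov'ev instance of record in LC form: `R₀² = R_a² = 689/625 = 1 + ε²`, `ε = 8/25`, `1/κ₀² = Ψ_ZZ/Ψ_RR`
on axis `= 758468676/2257675225` (`Models/SolovevPCF.lean`, `IterLike.hessian_axis`). [cite: PatakiCerfonFreidberg2013, §6.1] -/
def KInst.pcfIter : KInst := ⟨689 / 625, 8 / 25, 758468676 / 2257675225⟩

/-- The NSTX-like PCF Solov'ev instance of record in LC form: `R₀² = 4021/2500`, `ε = 39/50`, `1/κ₀² = 833319279/3382585600`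
(`Models/SolovevPCF.lean`, `NstxLike.hessian_axis`). [cite: PatakiCerfonFreidberg2013, §6.1] -/
def KInst.pcfNstx : KInst := ⟨4021 / 2500, 39 / 50, 833319279 / 3382585600⟩

/-- The arguments of one box pass: scale `S`, orders `P`, the `s`-panel `|s − cx| ≤ h`, instance `I`, branch `σ = ±1`, and the
`w`-box `|w − cy| ≤ k`. [cite: MakinoBerz2003, Algorithm 2] -/
structure BX where
  /-- scale -/
  S : ℕ
  /-- degree / series orders / Heron fuel -/
  P : EPrm
  /-- `s`-panel half-width -/
  h : ℚ
  /-- `s`-panel centre -/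
  cx : ℚ
  /-- instance data -/
  I : KInst
  /-- branch sign -/
  σ : ℚ
  /-- `w`-box half-width -/
  k : ℚ
  /-- `w`-box centre -/
  cy : ℚ

/-- `(1 + v²)⁻¹`, the Weierstrass denominator. [folklore] -/
noncomputable def ip (v : ℝ) : ℝ := (1 + v * v)⁻¹

/-- `cos t` on branch `σ`: `σ·(1 − v²)(1 + v²)⁻¹` (`σ = 1`: `t = 2arctan v ∈ [0, π/2]`; `σ = −1`: `t = π − 2arctan v`). [folklore] -/
noncomputable def cw (σ : ℚ) (w : ℝ) : ℝ := (σ : ℝ) * ((1 - w * w) * ip w)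

/-- `sin²t = 4v²(1 + v²)⁻²` (both branches). [folklore] -/
noncomputable def s2w (w : ℝ) : ℝ := 4 * ((w * w * ip w) * ip w)

/-- The Jacobian `dt/dv = 2(1 + v²)⁻¹`. [folklore] -/
noncomputable def jac (w : ℝ) : ℝ := 2 * ip w

/-- `u = R₀² + 2εs·cos t` along the surface of fraction `s`. [cite: LeeCerfon2015, §4.1 (boundary parametrisation)] -/
noncomputable def uu (I : KInst) (σ : ℚ) (s w : ℝ) : ℝ := (I.u0 : ℝ) + ((2 * I.eps : ℚ) : ℝ) * (s * cw σ w)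

/-- `(√u)⁻¹`. [folklore] -/
noncomputable def isu (I : KInst) (σ : ℚ) (s w : ℝ) : ℝ := (Real.sqrt (uu I σ s w))⁻¹

/-- `u⁻¹` written as `(√u)⁻¹·(√u)⁻¹` (equal to `u⁻¹` where `u ≥ 0`). [folklore] -/
noncomputable def iu (I : KInst) (σ : ℚ) (s w : ℝ) : ℝ := isu I σ s w * isu I σ s w

/-- `A = u cos t + εs·sin²t`. [cite: LeeCerfon2015, §4.1 (boundary parametrisation)] -/
noncomputable def aa (I : KInst) (σ : ℚ) (s w : ℝ) : ℝ := uu I σ s w * cw σ w + (I.eps : ℝ) * (s * s2w w)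

/-- `Q = u sin²t/κ² + A²/u` (model-7's `lcQ` along the substituted loop, with `1/u` as `iu`). [cite: LeeCerfon2015, §4.1 (boundary parametrisation)] -/
noncomputable def qq (I : KInst) (σ : ℚ) (s w : ℝ) : ℝ :=
  (I.invKsq : ℝ) * (uu I σ s w * s2w w) + iu I σ s w * (aa I σ s w * aa I σ s w)

/-- THE EIGHT SUBSTITUTED KERNELS (times the Jacobian `dt/dv`), `i = 0…7`:
`0: (√u)⁻¹J·u⁻¹` (`I_B`), `1: (√u)⁻¹J·Q⁻¹` (`I₆`), `2: (√u)⁻¹JQ⁻¹·u⁻¹` (`I₇`), `3: (√u)⁻¹JQ⁻¹·u` (`I₈`),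
`4: (√u)⁻¹JQ⁻¹·cos t` (`I_X` without its constant `2/R₀`), `5: (√u)⁻¹JQ⁻¹u⁻¹·cos²t` (`I_Y` without its `4`),
`6: (√u)⁻¹Ju⁻¹·u⁻¹·sin²t` (`sin²t·u^{−5/2}`: `D₃ = −3R₀·∫` of it, by parts), `7: (√u)⁻¹Ju⁻¹u⁻¹·u⁻¹·sin²t` (`sin²t·u^{−7/2}`:
`D₅ = −5R₀·∫₀^π` of it, by parts); any other index gives `0`.  The integration-by-parts forms of model-7's divided-difference
integrals (`(1/r)∫cos t·u^{−3/2} = −3R₀∫sin²t·u^{−5/2}`, `(1/r)∫₀^π cos t·u^{−5/2} = −5R₀∫₀^π sin²t·u^{−7/2}`, from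
`d(u^{−3/2})/dt = 3rR₀ sin t·u^{−5/2}` and `sin 0 = sin π = sin 2π = 0`) are what make every kernel a product of the four
registers `(√u)⁻¹, u⁻¹, Q⁻¹, u` with the cheap trigonometric ones — no `√u − R₀` anywhere. [cite: Jardin2010, §8.5.4 eq. (8.134)] -/
noncomputable def ker (I : KInst) (σ : ℚ) (i : ℕ) (s w : ℝ) : ℝ :=
  match i with
  | 0 => isu I σ s w * jac w * iu I σ s w
  | 1 => isu I σ s w * jac w * (qq I σ s w)⁻¹
  | 2 => isu I σ s w * jac w * (qq I σ s w)⁻¹ * iu I σ s w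
  | 3 => isu I σ s w * jac w * (qq I σ s w)⁻¹ * uu I σ s w
  | 4 => isu I σ s w * jac w * (qq I σ s w)⁻¹ * cw σ w
  | 5 => isu I σ s w * jac w * (qq I σ s w)⁻¹ * iu I σ s w * (cw σ w * cw σ w)
  | 6 => isu I σ s w * jac w * iu I σ s w * iu I σ s w * s2w w
  | 7 => isu I σ s w * jac w * iu I σ s w * iu I σ s w * iu I σ s w * s2w w
  | _ => 0

/-! ## §2 The box registers and the vector box rule -/

namespace BX

variable (b : BX)

/-- `s = cx + ρ` (the identity model: the surface label is a genuine Taylor-model variable). [cite: MakinoBerz2003, Algorithm 2] -/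
def mX : IPoly2 := tvarX2 b.S (ofRat b.S b.cx)
/-- `v = cy + τ`. [cite: MakinoBerz2003, Algorithm 2] -/
def mY : IPoly2 := tvarY2 b.S (ofRat b.S b.cy)
/-- `v²`. [cite: MakinoBerz2003, Algorithm 2] -/
def mY2 : IPoly2 := tmul2 b.S b.h b.k b.P.D b.mY b.mY
/-- `(1 + v²)⁻¹` with flag. [cite: MakinoBerz2003, Definition 3] -/
def mIP : IPoly2 × Bool := tinv2TM b.S b.h b.k b.P.D b.P.K (tadd2 (tconst2 (ofRat b.S 1)) b.mY2)
/-- `cos t = σ(1 − v²)(1 + v²)⁻¹`. [cite: MakinoBerz2003, Algorithm 2] -/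
def mC : IPoly2 := tsmulI2 b.S (ofRat b.S b.σ) (tmul2 b.S b.h b.k b.P.D (tsub2 (tconst2 (ofRat b.S 1)) b.mY2) b.mIP.1)
/-- `sin²t = 4v²(1 + v²)⁻²`. [cite: MakinoBerz2003, Algorithm 2] -/
def mS2 : IPoly2 :=
  tsmulI2 b.S (ofRat b.S 4) (tmul2 b.S b.h b.k b.P.D (tmul2 b.S b.h b.k b.P.D b.mY2 b.mIP.1) b.mIP.1)
/-- `dt/dv = 2(1 + v²)⁻¹`. [cite: MakinoBerz2003, Algorithm 2] -/
def mJ : IPoly2 := tsmulI2 b.S (ofRat b.S 2) b.mIP.1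
/-- `u`. [cite: MakinoBerz2003, Algorithm 2] -/
def mU : IPoly2 :=
  tadd2 (tconst2 (ofRat b.S b.I.u0)) (tsmulI2 b.S (ofRat b.S (2 * b.I.eps)) (tmul2 b.S b.h b.k b.P.D b.mX b.mC))
/-- `√u` with flag. [cite: MakinoBerz2003, Definition 3] -/
def mSU : IPoly2 × Bool := tsqrt2TM b.S b.h b.k b.P.D b.P.K b.P.fuel b.mU
/-- `(√u)⁻¹` with flag. [cite: MakinoBerz2003, Definition 3] -/
def mISU : IPoly2 × Bool := tinv2TM b.S b.h b.k b.P.D b.P.K b.mSU.1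
/-- `u⁻¹ = (√u)⁻¹(√u)⁻¹`. [cite: MakinoBerz2003, Algorithm 2] -/
def mIU : IPoly2 := tmul2 b.S b.h b.k b.P.D b.mISU.1 b.mISU.1
/-- `A = u cos t + εs sin²t`. [cite: MakinoBerz2003, Algorithm 2] -/
def mA : IPoly2 :=
  tadd2 (tmul2 b.S b.h b.k b.P.D b.mU b.mC) (tsmulI2 b.S (ofRat b.S b.I.eps) (tmul2 b.S b.h b.k b.P.D b.mX b.mS2))
/-- `Q`. [cite: MakinoBerz2003, Algorithm 2] -/
def mQ : IPoly2 :=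
  tadd2 (tsmulI2 b.S (ofRat b.S b.I.invKsq) (tmul2 b.S b.h b.k b.P.D b.mU b.mS2))
    (tmul2 b.S b.h b.k b.P.D b.mIU (tmul2 b.S b.h b.k b.P.D b.mA b.mA))
/-- `Q⁻¹` with flag. [cite: MakinoBerz2003, Definition 3] -/
def mIQ : IPoly2 × Bool := tinv2TM b.S b.h b.k b.P.D b.P.K b.mQ
/-- `(√u)⁻¹·dt/dv`. [cite: MakinoBerz2003, Algorithm 2] -/
def mIJ : IPoly2 := tmul2 b.S b.h b.k b.P.D b.mISU.1 b.mJ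
/-- kernel 0: `(√u)⁻¹Ju⁻¹`. [cite: MakinoBerz2003, Algorithm 2] -/
def mK0 : IPoly2 := tmul2 b.S b.h b.k b.P.D b.mIJ b.mIU
/-- kernel 1: `(√u)⁻¹JQ⁻¹`. [cite: MakinoBerz2003, Algorithm 2] -/
def mK1 : IPoly2 := tmul2 b.S b.h b.k b.P.D b.mIJ b.mIQ.1
/-- kernel 2. [cite: MakinoBerz2003, Algorithm 2] -/
def mK2 : IPoly2 := tmul2 b.S b.h b.k b.P.D b.mK1 b.mIU
/-- kernel 3. [cite: MakinoBerz2003, Algorithm 2] -/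
def mK3 : IPoly2 := tmul2 b.S b.h b.k b.P.D b.mK1 b.mU
/-- kernel 4. [cite: MakinoBerz2003, Algorithm 2] -/
def mK4 : IPoly2 := tmul2 b.S b.h b.k b.P.D b.mK1 b.mC
/-- `cos²t`. [cite: MakinoBerz2003, Algorithm 2] -/
def mCC : IPoly2 := tmul2 b.S b.h b.k b.P.D b.mC b.mC
/-- kernel 5. [cite: MakinoBerz2003, Algorithm 2] -/
def mK5 : IPoly2 := tmul2 b.S b.h b.k b.P.D b.mK2 b.mCC
/-- kernel 6 (`sin²t·u^{−5/2}·J`). [cite: MakinoBerz2003, Algorithm 2] -/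
def mK6 : IPoly2 := tmul2 b.S b.h b.k b.P.D (tmul2 b.S b.h b.k b.P.D b.mK0 b.mIU) b.mS2
/-- kernel 7 (`sin²t·u^{−7/2}·J`). [cite: MakinoBerz2003, Algorithm 2] -/
def mK7 : IPoly2 := tmul2 b.S b.h b.k b.P.D b.mK6 b.mIU
/-- The conjunctive acceptance flag of the four intrinsic nodes. [cite: MakinoBerz2003, Definition 3] -/
def ok : Bool := b.mIP.2 && b.mSU.2 && b.mISU.2 && b.mIQ.2
/-- The eight kernel models of the box. [cite: MakinoBerz2003, Algorithm 2] -/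
def kers : List IPoly2 := [b.mK0, b.mK1, b.mK2, b.mK3, b.mK4, b.mK5, b.mK6, b.mK7]

end BX

/-- **THE VECTOR BOX RULE**: for the `s`-panel `|s − cx| ≤ h`, instance `I`, branch `σ`, and the `w`-box `|w − cy| ≤ k`, the eight
kernel models (total degree `P.D`, intrinsic order `P.K`, Heron fuel `P.fuel`) with the conjunctive acceptance flag.
[cite: MakinoBerz2003, Algorithm 2] -/
def kerBox (S : ℕ) (P : EPrm) (h cx : ℚ) (I : KInst) (σ : ℚ) (k cy : ℚ) : List IPoly2 × Bool :=
  let b : BX := ⟨S, P, h, cx, I, σ, k, cy⟩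
  (b.kers, b.ok)

/-! ## §3 Soundness -/

/-- Transport of a bivariate membership along a pointwise equality of functions. [folklore] -/
theorem tmem2_congr {S : ℕ} {h k : ℚ} {f g : ℝ → ℝ → ℝ} {Q : IPoly2} (hf : TMem2 S h k f Q)
    (hfg : ∀ ρ τ, f ρ τ = g ρ τ) : TMem2 S h k g Q := fun ρ τ hρ hτ => by
  obtain ⟨p, hp, e⟩ := hf ρ τ hρ hτ; exact ⟨p, hp, by rw [← hfg, e]⟩

namespace BX

variable (b : BX) (hS : 0 < b.S) (h0 : 0 ≤ b.h) (k0 : 0 ≤ b.k)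

/-- Shorthand: register `M` encloses the real function `f(s, w)` on the box, in panel coordinates. [cite: MakinoBerz2003, Definition 1] -/
abbrev Enc (f : ℝ → ℝ → ℝ) (M : IPoly2) : Prop :=
  TMem2 b.S b.h b.k (fun ρ τ => f ((b.cx : ℝ) + ρ) ((b.cy : ℝ) + τ)) M

/-- [cite: MakinoBerz2003, Algorithm 2] -/
theorem enc_X : b.Enc (fun s _ => s) b.mX := tmem2_varX (mem_ofRat b.S b.cx)

include hS h0 k0
/-- [cite: MakinoBerz2003, Algorithm 2] -/
theorem enc_Y2 : b.Enc (fun _ w => w * w) b.mY2 :=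
  tmem2_mul hS h0 k0 b.P.D (tmem2_varY (mem_ofRat b.S b.cy)) (tmem2_varY (mem_ofRat b.S b.cy))
/-- [cite: MakinoBerz2003, Definition 3] -/
theorem enc_IP (h1 : b.mIP.2 = true) : b.Enc (fun _ w => ip w) b.mIP.1 := by
  have h1' : TMem2 b.S b.h b.k (fun _ _ => (1 : ℝ)) (tconst2 (ofRat b.S 1)) := by
    simpa using tmem2_const (h := b.h) (k := b.k) (mem_ofRat b.S 1)
  exact tmem2_congr (tmem2_inv_of_tinv2TM hS h0 k0 (tmem2_add h1' (b.enc_Y2 hS h0 k0)) h1) (fun ρ τ => by simp only [ip])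
/-- [cite: MakinoBerz2003, Algorithm 2] -/
theorem enc_C (h1 : b.mIP.2 = true) : b.Enc (fun _ w => cw b.σ w) b.mC := by
  have h1' : TMem2 b.S b.h b.k (fun _ _ => (1 : ℝ)) (tconst2 (ofRat b.S 1)) := by
    simpa using tmem2_const (h := b.h) (k := b.k) (mem_ofRat b.S 1)
  exact tmem2_congr (tmem2_smulI hS (h := b.h) (k := b.k) (mem_ofRat b.S b.σ)
    (tmem2_mul hS h0 k0 b.P.D (tmem2_sub h1' (b.enc_Y2 hS h0 k0)) (b.enc_IP hS h0 k0 h1))) (fun ρ τ => by simp only [cw])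
/-- [cite: MakinoBerz2003, Algorithm 2] -/
theorem enc_S2 (h1 : b.mIP.2 = true) : b.Enc (fun _ w => s2w w) b.mS2 :=
  tmem2_congr (tmem2_smulI hS (h := b.h) (k := b.k) (mem_ofRat b.S 4)
    (tmem2_mul hS h0 k0 b.P.D (tmem2_mul hS h0 k0 b.P.D (b.enc_Y2 hS h0 k0) (b.enc_IP hS h0 k0 h1))
      (b.enc_IP hS h0 k0 h1))) (fun ρ τ => by simp only [s2w]; push_cast; ring)
/-- [cite: MakinoBerz2003, Algorithm 2] -/
theorem enc_J (h1 : b.mIP.2 = true) : b.Enc (fun _ w => jac w) b.mJ :=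
  tmem2_congr (tmem2_smulI hS (h := b.h) (k := b.k) (mem_ofRat b.S 2) (b.enc_IP hS h0 k0 h1))
    (fun ρ τ => by simp only [jac]; push_cast; ring)
/-- [cite: MakinoBerz2003, Algorithm 2] -/
theorem enc_U (hp : b.mIP.2 = true) : b.Enc (fun s w => uu b.I b.σ s w) b.mU :=
  tmem2_congr (tmem2_add (tmem2_const (mem_ofRat b.S b.I.u0))
    (tmem2_smulI hS (h := b.h) (k := b.k) (mem_ofRat b.S (2 * b.I.eps))
      (tmem2_mul hS h0 k0 b.P.D b.enc_X (b.enc_C hS h0 k0 hp)))) (fun ρ τ => by simp only [uu])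
/-- [cite: MakinoBerz2003, Definition 3] -/
theorem enc_SU (hp : b.mIP.2 = true) (h1 : b.mSU.2 = true) : b.Enc (fun s w => Real.sqrt (uu b.I b.σ s w)) b.mSU.1 :=
  tmem2_sqrt_of_tsqrt2TM hS h0 k0 (b.enc_U hS h0 k0 hp) h1
/-- [cite: MakinoBerz2003, Definition 3] -/
theorem enc_ISU (hp : b.mIP.2 = true) (h1 : b.mSU.2 = true) (h2 : b.mISU.2 = true) :
    b.Enc (fun s w => isu b.I b.σ s w) b.mISU.1 :=
  tmem2_congr (tmem2_inv_of_tinv2TM hS h0 k0 (b.enc_SU hS h0 k0 hp h1) h2) (fun ρ τ => by simp only [isu])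
/-- [cite: MakinoBerz2003, Algorithm 2] -/
theorem enc_IU (hp : b.mIP.2 = true) (h1 : b.mSU.2 = true) (h2 : b.mISU.2 = true) :
    b.Enc (fun s w => iu b.I b.σ s w) b.mIU :=
  tmem2_congr (tmem2_mul hS h0 k0 b.P.D (b.enc_ISU hS h0 k0 hp h1 h2) (b.enc_ISU hS h0 k0 hp h1 h2))
    (fun ρ τ => by simp only [iu])
/-- [cite: MakinoBerz2003, Algorithm 2] -/
theorem enc_A (hp : b.mIP.2 = true) : b.Enc (fun s w => aa b.I b.σ s w) b.mA :=
  tmem2_congr (tmem2_add (tmem2_mul hS h0 k0 b.P.D (b.enc_U hS h0 k0 hp) (b.enc_C hS h0 k0 hp))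
    (tmem2_smulI hS (h := b.h) (k := b.k) (mem_ofRat b.S b.I.eps)
      (tmem2_mul hS h0 k0 b.P.D b.enc_X (b.enc_S2 hS h0 k0 hp)))) (fun ρ τ => by simp only [aa])
/-- [cite: MakinoBerz2003, Algorithm 2] -/
theorem enc_Q (hp : b.mIP.2 = true) (h1 : b.mSU.2 = true) (h2 : b.mISU.2 = true) :
    b.Enc (fun s w => qq b.I b.σ s w) b.mQ :=
  tmem2_congr (tmem2_add
    (tmem2_smulI hS (h := b.h) (k := b.k) (mem_ofRat b.S b.I.invKsq)
      (tmem2_mul hS h0 k0 b.P.D (b.enc_U hS h0 k0 hp) (b.enc_S2 hS h0 k0 hp)))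
    (tmem2_mul hS h0 k0 b.P.D (b.enc_IU hS h0 k0 hp h1 h2)
      (tmem2_mul hS h0 k0 b.P.D (b.enc_A hS h0 k0 hp) (b.enc_A hS h0 k0 hp)))) (fun ρ τ => by simp only [qq])
/-- [cite: MakinoBerz2003, Definition 3] -/
theorem enc_IQ (hp : b.mIP.2 = true) (h1 : b.mSU.2 = true) (h2 : b.mISU.2 = true) (h3 : b.mIQ.2 = true) :
    b.Enc (fun s w => (qq b.I b.σ s w)⁻¹) b.mIQ.1 :=
  tmem2_inv_of_tinv2TM hS h0 k0 (b.enc_Q hS h0 k0 hp h1 h2) h3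

/-- [cite: MakinoBerz2003, Algorithm 2] -/
theorem enc_IJ (hp : b.mIP.2 = true) (h3 : b.mSU.2 = true) (h4 : b.mISU.2 = true) :
    b.Enc (fun s w => isu b.I b.σ s w * jac w) b.mIJ :=
  tmem2_mul hS h0 k0 b.P.D (b.enc_ISU hS h0 k0 hp h3 h4) (b.enc_J hS h0 k0 hp)

/-- kernel 0 enclosed. [cite: MakinoBerz2003, Algorithm 2] -/
theorem enc_K0 (hp : b.mIP.2 = true) (h3 : b.mSU.2 = true) (h4 : b.mISU.2 = true) :
    b.Enc (fun s w => ker b.I b.σ 0 s w) b.mK0 :=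
  tmem2_congr (tmem2_mul hS h0 k0 b.P.D (b.enc_IJ hS h0 k0 hp h3 h4) (b.enc_IU hS h0 k0 hp h3 h4))
    (fun ρ τ => by simp only [ker])
/-- kernel 1 enclosed. [cite: MakinoBerz2003, Algorithm 2] -/
theorem enc_K1 (hp : b.mIP.2 = true) (h3 : b.mSU.2 = true) (h4 : b.mISU.2 = true)
    (h5 : b.mIQ.2 = true) : b.Enc (fun s w => ker b.I b.σ 1 s w) b.mK1 :=
  tmem2_congr (tmem2_mul hS h0 k0 b.P.D (b.enc_IJ hS h0 k0 hp h3 h4) (b.enc_IQ hS h0 k0 hp h3 h4 h5))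
    (fun ρ τ => by simp only [ker])
/-- kernel 2 enclosed. [cite: MakinoBerz2003, Algorithm 2] -/
theorem enc_K2 (hp : b.mIP.2 = true) (h3 : b.mSU.2 = true) (h4 : b.mISU.2 = true)
    (h5 : b.mIQ.2 = true) : b.Enc (fun s w => ker b.I b.σ 2 s w) b.mK2 :=
  tmem2_congr (tmem2_mul hS h0 k0 b.P.D (b.enc_K1 hS h0 k0 hp h3 h4 h5) (b.enc_IU hS h0 k0 hp h3 h4))
    (fun ρ τ => by simp only [ker])
/-- kernel 3 enclosed. [cite: MakinoBerz2003, Algorithm 2] -/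
theorem enc_K3 (hp : b.mIP.2 = true) (h3 : b.mSU.2 = true) (h4 : b.mISU.2 = true)
    (h5 : b.mIQ.2 = true) : b.Enc (fun s w => ker b.I b.σ 3 s w) b.mK3 :=
  tmem2_congr (tmem2_mul hS h0 k0 b.P.D (b.enc_K1 hS h0 k0 hp h3 h4 h5) (b.enc_U hS h0 k0 hp))
    (fun ρ τ => by simp only [ker])
/-- kernel 4 enclosed. [cite: MakinoBerz2003, Algorithm 2] -/
theorem enc_K4 (hp : b.mIP.2 = true) (h3 : b.mSU.2 = true) (h4 : b.mISU.2 = true)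
    (h5 : b.mIQ.2 = true) : b.Enc (fun s w => ker b.I b.σ 4 s w) b.mK4 :=
  tmem2_congr (tmem2_mul hS h0 k0 b.P.D (b.enc_K1 hS h0 k0 hp h3 h4 h5) (b.enc_C hS h0 k0 hp))
    (fun ρ τ => by simp only [ker])
/-- `cos²t` enclosed. [cite: MakinoBerz2003, Algorithm 2] -/
theorem enc_CC (hp : b.mIP.2 = true) : b.Enc (fun _ w => cw b.σ w * cw b.σ w) b.mCC :=
  tmem2_mul hS h0 k0 b.P.D (b.enc_C hS h0 k0 hp) (b.enc_C hS h0 k0 hp)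
/-- kernel 5 enclosed. [cite: MakinoBerz2003, Algorithm 2] -/
theorem enc_K5 (hp : b.mIP.2 = true) (h3 : b.mSU.2 = true) (h4 : b.mISU.2 = true)
    (h5 : b.mIQ.2 = true) : b.Enc (fun s w => ker b.I b.σ 5 s w) b.mK5 :=
  tmem2_congr (tmem2_mul hS h0 k0 b.P.D (b.enc_K2 hS h0 k0 hp h3 h4 h5) (b.enc_CC hS h0 k0 hp))
    (fun ρ τ => by simp only [ker])

/-- kernel 6 enclosed. [cite: MakinoBerz2003, Algorithm 2] -/
theorem enc_K6 (hp : b.mIP.2 = true) (h3 : b.mSU.2 = true) (h4 : b.mISU.2 = true) :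
    b.Enc (fun s w => ker b.I b.σ 6 s w) b.mK6 :=
  tmem2_congr (tmem2_mul hS h0 k0 b.P.D (tmem2_mul hS h0 k0 b.P.D (b.enc_K0 hS h0 k0 hp h3 h4) (b.enc_IU hS h0 k0 hp h3 h4))
    (b.enc_S2 hS h0 k0 hp)) (fun ρ τ => by simp only [ker])
/-- kernel 7 enclosed. [cite: MakinoBerz2003, Algorithm 2] -/
theorem enc_K7 (hp : b.mIP.2 = true) (h3 : b.mSU.2 = true) (h4 : b.mISU.2 = true) :
    b.Enc (fun s w => ker b.I b.σ 7 s w) b.mK7 :=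
  tmem2_congr (tmem2_mul hS h0 k0 b.P.D (b.enc_K6 hS h0 k0 hp h3 h4) (b.enc_IU hS h0 k0 hp h3 h4))
    (fun ρ τ => by simp only [ker]; ring)

/-- **Soundness of the box pass**: on acceptance, the `i`-th kernel model encloses `ker I σ i` in panel/box coordinates.
[cite: MakinoBerz2003, Algorithm 2] -/
theorem enc_kers (hok : b.ok = true) {i : ℕ} (hi : i < 8) :
    b.Enc (fun s w => ker b.I b.σ i s w) (b.kers.getD i []) := by
  simp only [ok, Bool.and_eq_true] at hok
  obtain ⟨⟨⟨hp, h3⟩, h4⟩, h5⟩ := hok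
  interval_cases i <;> simp only [kers, List.getD_cons_zero, List.getD_cons_succ]
  · exact b.enc_K0 hS h0 k0 hp h3 h4
  · exact b.enc_K1 hS h0 k0 hp h3 h4 h5
  · exact b.enc_K2 hS h0 k0 hp h3 h4 h5
  · exact b.enc_K3 hS h0 k0 hp h3 h4 h5
  · exact b.enc_K4 hS h0 k0 hp h3 h4 h5
  · exact b.enc_K5 hS h0 k0 hp h3 h4 h5
  · exact b.enc_K6 hS h0 k0 hp h3 h4
  · exact b.enc_K7 hS h0 k0 hp h3 h4

end BX

/-- **SOUNDNESS OF THE VECTOR BOX RULE**: for every scale `S > 0`, `s`-panel `|s − cx| ≤ h` (`h ≥ 0`), instance data `I` and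
branch `σ`, the rule `kerBox S P h cx I σ` is a sound vector box rule for the eight kernels `i ↦ ((u, y) ↦ ker I σ i (cx + u) y)` in
the sense of `StripSoundV` (`TaylorModelIntegralCertStrip.lean`).
[cite: MakinoBerz2003, Algorithm 2] -/
theorem kerBox_sound {S : ℕ} (hS : 0 < S) (P : EPrm) {h : ℚ} (h0 : 0 ≤ h) (cx : ℚ) (I : KInst) (σ : ℚ) :
    StripSoundV S h 8 (fun i u y => ker I σ i ((cx : ℝ) + u) y) (kerBox S P h cx I σ) := by
  intro k cy hok k0
  refine ⟨rfl, fun i hi => ?_⟩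
  have h := BX.enc_kers ⟨S, P, h, cx, I, σ, k, cy⟩ hS h0 k0 hok hi
  exact h

end Summit.Ventures.FusionMHD.Models.LcMercierProfile
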